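import Summits.AtomisticToContinuum.Crystallization.Theorems.ExcessDecayLiouvilleHcpLiouvilleBlowdownDefs
import Summits.AtomisticToContinuum.Crystallization.Theorems.ExcessDecayLiouvilleDiscreteSobolev3D
import Summits.AtomisticToContinuum.Crystallization.Theorems.ExcessDecayLiouvilleLatticeParam

/-!
# `ExcessDecayLiouville.HcpLiouville` (stmt-AtomisticToContinuum-9332), line `Sketch` (skeleton v4): sub-goal `blowdown_latticeSobolev3`

Part D3 of `stub_interior` (the interior estimate for `L`-harmonic fields): the **lattice Sobolev inequality on a
cube of the two-lattice**.  For a field `G` on the sites `S = Sites₀ t A`, a centre `c`, a scale `ℓ ≥ 8` and a site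
`p₀` with `dist p₀ c ≤ ℓ`,

`‖G p₀‖² ≤ 64 · ( ℓ⁻³ Σ'_{B_{5ℓ}} ‖G‖² + ℓ⁻¹ Σ' Σ_e ‖D_e G‖² + ℓ Σ' Σ_{e,e'} ‖D_e D_{e'} G‖² + ℓ³ Σ' Σ_{e,e',e''} ‖D_e D_{e'} D_{e''} G‖² )`,

where `D_e G p = G (p + A e) − G p` for the three generators `e ∈ {u₁, u₂, w₃}` of `Λ₀` and `Σ'` runs over the finite
set of sites of `B_{5ℓ}(c)`.  It is pure lattice bookkeeping around the landed tensor inequality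
`norm_sq_le_tensor_three` (…DiscreteSobolev3D): the cube `p₀ + A(a u₁ + b u₂ + d w₃)`, `a, b, d ≤ n := ⌊ℓ/2⌋₊`, is
injectively parametrised (`Blowdown.siteCube_injective`), consists of sites of `B_{5ℓ}(c)` (`Blowdown.siteCube_mem`),
its coordinate shifts are the translations by `A u₁, A u₂, A w₃` (`Blowdown.siteCube_shift`), so each of the eight box
sums of the tensor inequality is dominated by the corresponding ball sum (`Blowdown.sum_box_le_tsum_sitesBall`), and
the coefficients `(2/(n+1))^{3−|S|}(2n)^{|S|}` are `≤ 64 ℓ^{2|S|−3}` (`Blowdown.latticeSobolev_arith`).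

All `[folklore]`; a `--supports` helper for item stmt-AtomisticToContinuum-9332, nothing here closes an item.
-/

noncomputable section

namespace Summit.AtomisticToContinuum.Crystallization.Theorems.ExcessDecayLiouville

open scoped BigOperators Topology Classical InnerProductSpace RealInnerProductSpace
open Literature.MathematicalPhysics.StatisticalMechanics
open Summit.AtomisticToContinuum.Crystallization.Theses.ExcessDecayLiouville
open Summit.AtomisticToContinuum.Crystallization.Theorems.PhononStabilityNegative

namespace Blowdown

variable {t : Fin 2 → (EuclideanSpace ℝ (Fin 3))} {A : (EuclideanSpace ℝ (Fin 3)) →L[ℝ] (EuclideanSpace ℝ (Fin 3))}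

/-! ## Elementary rearrangements -/

/-- Second mixed difference, regrouped: `‖(a − b) − (c − d)‖ = ‖a − b − c + d‖`. [folklore] -/
theorem norm_diff₂_eq {F : Type*} [SeminormedAddCommGroup F] (a b c d : F) :
    ‖(a - b) - (c - d)‖ = ‖a - b - c + d‖ := by
  congr 1; abel

/-- Third mixed difference, regrouped. [folklore] -/
theorem norm_diff₃_eq {F : Type*} [SeminormedAddCommGroup F] (a b c d e f g h : F) :
    ‖((a - b) - (c - d)) - ((e - f) - (g - h))‖ = ‖a - b - c - e + d + f + g - h‖ := by
  congr 1; abel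

/-- A nonnegative double family dominates each of its terms. [folklore] -/
theorem le_sum_sum {ι : Type*} {s : Finset ι} (f : ι → ι → ℝ) (hf : ∀ a b, 0 ≤ f a b) {a b : ι}
    (ha : a ∈ s) (hb : b ∈ s) : f a b ≤ ∑ x ∈ s, ∑ y ∈ s, f x y :=
  (Finset.single_le_sum (f := f a) (fun y _ => hf a y) hb).trans
    (Finset.single_le_sum (f := fun x => ∑ y ∈ s, f x y)
      (fun x _ => Finset.sum_nonneg fun y _ => hf x y) ha)

/-- A nonnegative triple family dominates each of its terms. [folklore] -/
theorem le_sum_sum_sum {ι : Type*} {s : Finset ι} (f : ι → ι → ι → ℝ) (hf : ∀ a b d, 0 ≤ f a b d)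
    {a b d : ι} (ha : a ∈ s) (hb : b ∈ s) (hd : d ∈ s) :
    f a b d ≤ ∑ x ∈ s, ∑ y ∈ s, ∑ z ∈ s, f x y z :=
  (le_sum_sum (f a) (hf a) hb hd).trans
    (Finset.single_le_sum (f := fun x => ∑ y ∈ s, ∑ z ∈ s, f x y z)
      (fun x _ => Finset.sum_nonneg fun y _ => Finset.sum_nonneg fun z _ => hf x y z) ha)

/-- **Coefficient bookkeeping** of the tensor inequality: with `0 ≤ a ≤ 4ℓ⁻¹`, `0 ≤ b ≤ ℓ` and the eight box sums
dominated by the four ball sums, the right-hand side of `norm_sq_le_tensor_three` is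
`≤ 64 (ℓ⁻³ T₀ + ℓ⁻¹ T₁ + ℓ T₂ + ℓ³ T₃)`. [folklore] -/
theorem latticeSobolev_arith {X a b ℓ S₀ S₁ S₂ S₁₂ S₃ S₂₃ S₁₃ S₁₂₃ T₀ T₁ T₂ T₃ : ℝ} (hℓ : 0 < ℓ)
    (ha : 0 ≤ a) (hb : 0 ≤ b) (ha' : a ≤ 4 * ℓ⁻¹) (hb' : b ≤ ℓ)
    (hX : X ≤ a * (a * a * S₀ + a * b * S₂ + b * a * S₁ + b * b * S₁₂) +
      b * (a * a * S₃ + a * b * S₂₃ + b * a * S₁₃ + b * b * S₁₂₃))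
    (h₀ : S₀ ≤ T₀) (h₂ : S₂ ≤ T₁) (h₁ : S₁ ≤ T₁) (h₁₂ : S₁₂ ≤ T₂) (h₃ : S₃ ≤ T₁) (h₂₃ : S₂₃ ≤ T₂)
    (h₁₃ : S₁₃ ≤ T₂) (h₁₂₃ : S₁₂₃ ≤ T₃) (hT₀ : 0 ≤ T₀) (hT₁ : 0 ≤ T₁) (hT₂ : 0 ≤ T₂) (hT₃ : 0 ≤ T₃) :
    X ≤ 64 * ((ℓ⁻¹) ^ 3 * T₀ + ℓ⁻¹ * T₁ + ℓ * T₂ + ℓ ^ 3 * T₃) := by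
  have hl : 0 < ℓ⁻¹ := inv_pos.2 hℓ
  have hu : ℓ⁻¹ * ℓ = 1 := inv_mul_cancel₀ hℓ.ne'
  have haaa : a * a * a ≤ 64 * (ℓ⁻¹) ^ 3 :=
    calc a * a * a = a ^ 3 := by ring
      _ ≤ (4 * ℓ⁻¹) ^ 3 := pow_le_pow_left₀ ha ha' 3
      _ = 64 * (ℓ⁻¹) ^ 3 := by ring
  have haab : a * a * b ≤ 16 * ℓ⁻¹ :=
    calc a * a * b ≤ 4 * ℓ⁻¹ * (4 * ℓ⁻¹) * ℓ :=
          mul_le_mul (mul_le_mul ha' ha' ha (by positivity)) hb' hb (by positivity)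
      _ = 16 * ℓ⁻¹ * (ℓ⁻¹ * ℓ) := by ring
      _ = 16 * ℓ⁻¹ := by rw [hu, mul_one]
  have habb : a * b * b ≤ 4 * ℓ :=
    calc a * b * b = a * (b * b) := by ring
      _ ≤ 4 * ℓ⁻¹ * (ℓ * ℓ) := mul_le_mul ha' (mul_le_mul hb' hb' hb hℓ.le) (mul_nonneg hb hb) (by positivity)
      _ = 4 * (ℓ⁻¹ * ℓ) * ℓ := by ring
      _ = 4 * ℓ := by rw [hu, mul_one]
  have hbbb : b * b * b ≤ ℓ ^ 3 :=
    calc b * b * b = b ^ 3 := by ring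
      _ ≤ ℓ ^ 3 := pow_le_pow_left₀ hb hb' 3
  -- `c S ≤ K T` from `0 ≤ c ≤ K`, `S ≤ T`, `0 ≤ T`
  have key : ∀ {c S T K : ℝ}, 0 ≤ c → S ≤ T → c ≤ K → 0 ≤ T → c * S ≤ K * T := fun hc hST hcK hT =>
    (mul_le_mul_of_nonneg_left hST hc).trans (mul_le_mul_of_nonneg_right hcK hT)
  have haa3 : 0 ≤ a * a * a := by positivity
  have haab0 : 0 ≤ a * a * b := by positivity
  have habb0 : 0 ≤ a * b * b := by positivity
  have hbbb0 : 0 ≤ b * b * b := by positivity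
  have hsum : a * (a * a * S₀ + a * b * S₂ + b * a * S₁ + b * b * S₁₂) +
      b * (a * a * S₃ + a * b * S₂₃ + b * a * S₁₃ + b * b * S₁₂₃) =
      a * a * a * S₀ + a * a * b * S₂ + a * a * b * S₁ + a * b * b * S₁₂ +
      (a * a * b * S₃ + a * b * b * S₂₃ + a * b * b * S₁₃ + b * b * b * S₁₂₃) := by ring
  have hp₁ : 0 ≤ ℓ⁻¹ * T₁ := by positivity
  have hp₂ : 0 ≤ ℓ * T₂ := by positivity
  have hp₃ : 0 ≤ ℓ ^ 3 * T₃ := by positivity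
  rw [hsum] at hX
  linarith [key haa3 h₀ haaa hT₀, key haab0 h₂ haab hT₁, key haab0 h₁ haab hT₁, key habb0 h₁₂ habb hT₂,
    key haab0 h₃ haab hT₁, key habb0 h₂₃ habb hT₂, key habb0 h₁₃ habb hT₂, key hbbb0 h₁₂₃ hbbb hT₃]

/-! ## The lattice cube `p₀ + A(a u₁ + b u₂ + d w₃)` -/

/-- Coordinate shifts of the cube parametrisation are the translations by `A u₁`, `A u₂`, `A w₃` (all seven shifted
corners, in the normal form used below), and the corner `(0,0,0)` is `p₀`. [folklore] -/
theorem siteCube_shift {p₀ : EuclideanSpace ℝ (Fin 3)} {ψ : ℕ → ℕ → ℕ → EuclideanSpace ℝ (Fin 3)}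
    (hψ : ∀ i j k : ℕ, ψ i j k = p₀ + A (((i : ℝ)) • triangularVec₁ 1 + ((j : ℝ)) • triangularVec₂ 1 +
      ((k : ℝ)) • layerNormal (2 * Real.sqrt (2 / 3)))) :
    (∀ i j k : ℕ, ψ (i + 1) j k = ψ i j k + A (triangularVec₁ 1)) ∧
    (∀ i j k : ℕ, ψ i (j + 1) k = ψ i j k + A (triangularVec₂ 1)) ∧
    (∀ i j k : ℕ, ψ i j (k + 1) = ψ i j k + A (layerNormal (2 * Real.sqrt (2 / 3)))) ∧
    (∀ i j k : ℕ, ψ (i + 1) (j + 1) k = ψ i j k + A (triangularVec₂ 1) + A (triangularVec₁ 1)) ∧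
    (∀ i j k : ℕ, ψ (i + 1) j (k + 1) =
      ψ i j k + A (triangularVec₁ 1) + A (layerNormal (2 * Real.sqrt (2 / 3)))) ∧
    (∀ i j k : ℕ, ψ i (j + 1) (k + 1) =
      ψ i j k + A (triangularVec₂ 1) + A (layerNormal (2 * Real.sqrt (2 / 3)))) ∧
    (∀ i j k : ℕ, ψ (i + 1) (j + 1) (k + 1) =
      ψ i j k + A (triangularVec₂ 1) + A (triangularVec₁ 1) + A (layerNormal (2 * Real.sqrt (2 / 3)))) ∧
    ψ 0 0 0 = p₀ := by
  refine ⟨fun i j k => ?_, fun i j k => ?_, fun i j k => ?_, fun i j k => ?_, fun i j k => ?_,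
    fun i j k => ?_, fun i j k => ?_, ?_⟩
  iterate 7
    simp only [hψ, Nat.cast_add, Nat.cast_one, add_smul, one_smul, map_add]
    abel
  simp only [hψ, Nat.cast_zero, zero_smul, add_zero, map_zero]

/-- The points of the cube of side `n ≤ ℓ/2` at a site `p₀ ∈ B_ℓ(c)` are sites of `B_{5ℓ}(c)`
(`‖A z(a,b,d)‖ ≤ (199/200)(a + b + 2d) ≤ 2ℓ`). [folklore] -/
theorem siteCube_mem (hA : Adm₀ A) {p₀ c : EuclideanSpace ℝ (Fin 3)} {ℓ : ℝ} (hp₀ : p₀ ∈ Sites₀ t A)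
    (hp₀c : dist p₀ c ≤ ℓ) {n : ℕ} (hn : (n : ℝ) ≤ ℓ / 2) {ψ : ℕ → ℕ → ℕ → EuclideanSpace ℝ (Fin 3)}
    (hψ : ∀ i j k : ℕ, ψ i j k = p₀ + A (((i : ℝ)) • triangularVec₁ 1 + ((j : ℝ)) • triangularVec₂ 1 +
      ((k : ℝ)) • layerNormal (2 * Real.sqrt (2 / 3)))) (i j k : ℕ) (hi : i ≤ n) (hj : j ≤ n) (hk : k ≤ n) :
    ψ i j k ∈ Sites₀ t A ∧ dist (ψ i j k) c ≤ 5 * ℓ := by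
  rw [hψ]
  set z : EuclideanSpace ℝ (Fin 3) := ((i : ℝ)) • triangularVec₁ 1 + ((j : ℝ)) • triangularVec₂ 1 +
      ((k : ℝ)) • layerNormal (2 * Real.sqrt (2 / 3)) with hzdef
  have hz : z ∈ Λ₀ := by
    have h := latticeVec_mem_Λ₀ (i : ℤ) (j : ℤ) (k : ℤ)
    simp only [Int.cast_natCast] at h
    exact h
  refine ⟨add_mem_sites₀ hp₀ hz, ?_⟩
  have hnorm : ‖z‖ ≤ i + j + 2 * k := by
    have h := norm_latticeVec_le (i : ℤ) (j : ℤ) (k : ℤ)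
    simp only [Int.cast_natCast, Nat.abs_cast] at h
    exact h
  have hA' := norm_apply_le_of_adm₀ hA z
  have hi' : (i : ℝ) ≤ n := Nat.cast_le.2 hi
  have hj' : (j : ℝ) ≤ n := Nat.cast_le.2 hj
  have hk' : (k : ℝ) ≤ n := Nat.cast_le.2 hk
  have hℓ : 0 ≤ ℓ := dist_nonneg.trans hp₀c
  calc dist (p₀ + A z) c ≤ dist (p₀ + A z) p₀ + dist p₀ c := dist_triangle _ _ _
    _ = ‖A z‖ + dist p₀ c := by rw [dist_eq_norm, add_sub_cancel_left]
    _ ≤ 5 * ℓ := by nlinarith [norm_nonneg z]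

/-- The cube parametrisation is injective (`A` is injective and lattice coordinates are unique). [folklore] -/
theorem siteCube_injective (hA : Adm₀ A) {p₀ : EuclideanSpace ℝ (Fin 3)} {ψ : ℕ → ℕ → ℕ → EuclideanSpace ℝ (Fin 3)}
    (hψ : ∀ i j k : ℕ, ψ i j k = p₀ + A (((i : ℝ)) • triangularVec₁ 1 + ((j : ℝ)) • triangularVec₂ 1 +
      ((k : ℝ)) • layerNormal (2 * Real.sqrt (2 / 3)))) (i j k i' j' k' : ℕ) (h : ψ i j k = ψ i' j' k') :
    i = i' ∧ j = j' ∧ k = k' := by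
  rw [hψ, hψ] at h
  have h1 := injective_of_adm₀ hA (add_left_cancel h)
  have h2 := latticeCoords_eq (i := i) (j := j) (k := k) (i' := i') (j' := j') (k' := k')
    (by simpa only [Int.cast_natCast] using h1)
  exact ⟨by exact_mod_cast h2.1, by exact_mod_cast h2.2.1, by exact_mod_cast h2.2.2⟩

/-! ## Box sums against ball sums -/

/-- On the two-lattice the `tsum` over the sites of a ball is the finite sum over `finite_sites_dist_le`. [folklore] -/
theorem tsum_sitesBall_eq_sum (hA : Adm₀ A) (hI : Inner₀ t A) (c : EuclideanSpace ℝ (Fin 3)) (R : ℝ)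
    (F : EuclideanSpace ℝ (Fin 3) → ℝ) :
    ∑' p : {s : EuclideanSpace ℝ (Fin 3) // s ∈ Sites₀ t A ∧ dist s c ≤ R}, F p =
      ∑ p ∈ (finite_sites_dist_le hA hI c R).toFinset, F p := by
  rw [← Finset.tsum_subtype]
  exact tsum_congr_subtype F fun x => ((finite_sites_dist_le hA hI c R).mem_toFinset).symm

/-- **A box sum is dominated by the ball sum.** If the cube points `ψ i j k`, `i, j, k ≤ n`, are pairwise distinct
sites of `B_R(c)` and `g i j k ≤ F (ψ i j k)` with `F ≥ 0`, then every sub-box sum of `g` is at most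
`Σ'_{S ∩ B_R(c)} F`. [folklore] -/
theorem sum_box_le_tsum_sitesBall (hA : Adm₀ A) (hI : Inner₀ t A) {c : EuclideanSpace ℝ (Fin 3)} {R : ℝ} {n : ℕ}
    {ψ : ℕ → ℕ → ℕ → EuclideanSpace ℝ (Fin 3)}
    (hmem : ∀ i j k : ℕ, i ≤ n → j ≤ n → k ≤ n → ψ i j k ∈ Sites₀ t A ∧ dist (ψ i j k) c ≤ R)
    (hinj : ∀ i j k i' j' k' : ℕ, ψ i j k = ψ i' j' k' → i = i' ∧ j = j' ∧ k = k')
    {F : EuclideanSpace ℝ (Fin 3) → ℝ} (hF : ∀ p, 0 ≤ F p) {g : ℕ → ℕ → ℕ → ℝ}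
    (hg : ∀ i j k : ℕ, i ≤ n → j ≤ n → k ≤ n → g i j k ≤ F (ψ i j k))
    {s₁ s₂ s₃ : Finset ℕ} (h₁ : s₁ ⊆ Finset.range (n + 1)) (h₂ : s₂ ⊆ Finset.range (n + 1))
    (h₃ : s₃ ⊆ Finset.range (n + 1)) :
    ∑ k ∈ s₁, ∑ i ∈ s₂, ∑ j ∈ s₃, g i j k ≤
      ∑' p : {s : EuclideanSpace ℝ (Fin 3) // s ∈ Sites₀ t A ∧ dist s c ≤ R}, F p := by
  have hle : ∀ {a : ℕ}, a ∈ Finset.range (n + 1) → a ≤ n := fun h => Nat.lt_succ_iff.mp (Finset.mem_range.mp h)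
  rw [tsum_sitesBall_eq_sum hA hI c R F]
  calc ∑ k ∈ s₁, ∑ i ∈ s₂, ∑ j ∈ s₃, g i j k
      ≤ ∑ k ∈ s₁, ∑ i ∈ s₂, ∑ j ∈ s₃, F (ψ i j k) :=
        Finset.sum_le_sum fun k hk => Finset.sum_le_sum fun i hi => Finset.sum_le_sum fun j hj =>
          hg i j k (hle (h₂ hi)) (hle (h₃ hj)) (hle (h₁ hk))
    _ = ∑ x ∈ s₁ ×ˢ (s₂ ×ˢ s₃), F (ψ x.2.1 x.2.2 x.1) := by
        simp only [Finset.sum_product]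
    _ = ∑ p ∈ (s₁ ×ˢ (s₂ ×ˢ s₃)).image (fun x => ψ x.2.1 x.2.2 x.1), F p := by
        rw [Finset.sum_image]
        rintro ⟨k, i, j⟩ - ⟨k', i', j'⟩ - h
        obtain ⟨rfl, rfl, rfl⟩ := hinj _ _ _ _ _ _ h
        rfl
    _ ≤ ∑ p ∈ (finite_sites_dist_le hA hI c R).toFinset, F p := by
        refine Finset.sum_le_sum_of_subset_of_nonneg (fun p hp => ?_) fun p _ _ => hF p
        rw [Finset.mem_image] at hp
        obtain ⟨⟨k, i, j⟩, hx, rfl⟩ := hp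
        simp only [Finset.mem_product] at hx
        rw [Set.Finite.mem_toFinset]
        exact hmem i j k (hle (h₂ hx.2.1)) (hle (h₃ hx.2.2)) (hle (h₁ hx.1))

end Blowdown

/-- **Lattice Sobolev inequality on a cube of the two-lattice** (registered sub-goal `blowdown_latticeSobolev3`, part
D3 of `stub_interior`, crux stmt-AtomisticToContinuum-9332, line `Sketch` v4): a pointwise bound on a field at a site
of `B_ℓ(c)` by the ball sums over `B_{5ℓ}(c)` of the field and of its first, second and third generator differences,
with the scaling `ℓ^{2|S|−3}` and the constant `C = 64`. [folklore] -/
theorem blowdown_latticeSobolev3 : ∃ C : ℝ, ∀ (t : Fin 2 → (EuclideanSpace ℝ (Fin 3))) (A : (EuclideanSpace ℝ (Fin 3)) →L[ℝ] (EuclideanSpace ℝ (Fin 3))), Adm₀ A → Inner₀ t A → ∀ (G : (EuclideanSpace ℝ (Fin 3)) → (EuclideanSpace ℝ (Fin 3))) (c : (EuclideanSpace ℝ (Fin 3))) (ℓ : ℝ), 8 ≤ ℓ → ∀ p₀ ∈ Sites₀ t A, dist p₀ c ≤ ℓ → ‖G p₀‖ ^ 2 ≤ C * ((ℓ⁻¹)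 ^ 3 * ∑' p : {s : (EuclideanSpace ℝ (Fin 3)) // s ∈ Sites₀ t A ∧ dist s c ≤ 5 * ℓ}, ‖G p‖ ^ 2 + ℓ⁻¹ * ∑' p : {s : (EuclideanSpace ℝ (Fin 3)) // s ∈ Sites₀ t A ∧ dist s c ≤ 5 * ℓ}, ∑ e ∈ ({triangularVec₁ 1, triangularVec₂ 1, layerNormal (2 * Real.sqrt (2 / 3))} : Finset (EuclideanSpace ℝ (Fin 3))), ‖G (p + A e) - G p‖ ^ 2 + ℓ * ∑' p : {s : (EuclideanSpace ℝ (Fin 3)) // s ∈ Sites₀ t A ∧ dist s c ≤ 5 * ℓ}, ∑ e ∈ ({triangularVec₁ 1, triangularVec₂ 1, layerNormal (2 * Real.sqrt (2 / 3))} : Finset (EuclideanSpace ℝ (Fin 3))), ∑ e' ∈ ({triangularVec₁ 1, triangularVec₂ 1, layerNormal (2 * Real.sqrt (2 / 3))} : Finset (EuclideanSpace ℝ (Fin 3))), ‖G (p + A e + A e') - G (p + A e) - G (p + A e') + G p‖ ^ 2 + ℓ ^ 3 * ∑' p : {s : (EuclideanSpace ℝ (Fin 3)) // s ∈ Sites₀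 t A ∧ dist s c ≤ 5 * ℓ}, ∑ e ∈ ({triangularVec₁ 1, triangularVec₂ 1, layerNormal (2 * Real.sqrt (2 / 3))} : Finset (EuclideanSpace ℝ (Fin 3))), ∑ e' ∈ ({triangularVec₁ 1, triangularVec₂ 1, layerNormal (2 * Real.sqrt (2 / 3))} : Finset (EuclideanSpace ℝ (Fin 3))), ∑ e'' ∈ ({triangularVec₁ 1, triangularVec₂ 1, layerNormal (2 * Real.sqrt (2 / 3))} : Finset (EuclideanSpace ℝ (Fin 3))), ‖G (p + A e + A e' + A e'') - G (p + A e + A e') - G (p + A e + A e'') - G (p + A e' + A e'') + G (p + A e) + G (p + A e') + G (p + A e'') - G p‖ ^ 2) := by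
  refine ⟨64, ?_⟩
  intro t A hA hI G c ℓ hℓ p₀ hp₀ hp₀c
  obtain ⟨gens, hgens⟩ : ∃ gens : Finset (EuclideanSpace ℝ (Fin 3)),
      gens = {triangularVec₁ 1, triangularVec₂ 1, layerNormal (2 * Real.sqrt (2 / 3))} := ⟨_, rfl⟩
  rw [← hgens]
  have hm₁ : triangularVec₁ 1 ∈ gens := by rw [hgens]; simp
  have hm₂ : triangularVec₂ 1 ∈ gens := by rw [hgens]; simp
  have hm₃ : layerNormal (2 * Real.sqrt (2 / 3)) ∈ gens := by rw [hgens]; simp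
  obtain ⟨ψ, hψ⟩ : ∃ ψ : ℕ → ℕ → ℕ → EuclideanSpace ℝ (Fin 3), ∀ i j k : ℕ, ψ i j k =
      p₀ + A (((i : ℝ)) • triangularVec₁ 1 + ((j : ℝ)) • triangularVec₂ 1 +
        ((k : ℝ)) • layerNormal (2 * Real.sqrt (2 / 3))) := ⟨_, fun _ _ _ => rfl⟩
  obtain ⟨h100, h010, h001, h110, h101, h011, h111, h000⟩ := Blowdown.siteCube_shift hψ
  have hℓ0 : 0 < ℓ := by linarith
  set n : ℕ := ⌊ℓ / 2⌋₊ with hn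
  have hn1 : (n : ℝ) ≤ ℓ / 2 := Nat.floor_le (by positivity)
  have hn2 : ℓ / 2 < (n : ℝ) + 1 := Nat.lt_floor_add_one (ℓ / 2)
  have hmem := Blowdown.siteCube_mem hA hp₀ hp₀c hn1 hψ
  have hinj := Blowdown.siteCube_injective hA hψ
  have hr : ∀ {m : ℕ}, m ≤ n + 1 → Finset.range m ⊆ Finset.range (n + 1) := fun h =>
    Finset.range_subset_range.2 h
  have hmain := norm_sq_le_tensor_three (fun i j k => G (ψ i j k)) (Nat.zero_le n) (Nat.zero_le n)
    (Nat.zero_le n)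
  beta_reduce at hmain
  rw [h000] at hmain
  have ha : (0 : ℝ) ≤ 2 / ((n : ℝ) + 1) := by positivity
  have hb : (0 : ℝ) ≤ 2 * (n : ℝ) := by positivity
  have ha' : 2 / ((n : ℝ) + 1) ≤ 4 * ℓ⁻¹ := by
    have h1 : 2 / (ℓ / 2) = 4 * ℓ⁻¹ := by
      rw [div_div_eq_mul_div, div_eq_mul_inv]; norm_num
    rw [← h1]
    exact div_le_div_of_nonneg_left (by norm_num) (by positivity) hn2.le
  have hb' : 2 * (n : ℝ) ≤ ℓ := by linarith
  refine Blowdown.latticeSobolev_arith hℓ0 ha hb ha' hb' hmain ?_ ?_ ?_ ?_ ?_ ?_ ?_ ?_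
    (tsum_nonneg fun _ => sq_nonneg _)
    (tsum_nonneg fun _ => Finset.sum_nonneg fun _ _ => sq_nonneg _)
    (tsum_nonneg fun _ => Finset.sum_nonneg fun _ _ => Finset.sum_nonneg fun _ _ => sq_nonneg _)
    (tsum_nonneg fun _ => Finset.sum_nonneg fun _ _ => Finset.sum_nonneg fun _ _ =>
      Finset.sum_nonneg fun _ _ => sq_nonneg _)
  · -- `S_∅ ≤ T₀`
    exact Blowdown.sum_box_le_tsum_sitesBall hA hI hmem hinj (F := fun p => ‖G p‖ ^ 2)
      (fun _ => sq_nonneg _) (fun i j k _ _ _ => le_rfl)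
      (hr (by omega)) (hr (by omega)) (hr (by omega))
  · -- `S_{2} ≤ T₁`
    refine Blowdown.sum_box_le_tsum_sitesBall hA hI hmem hinj
      (F := fun p => ∑ e ∈ gens, ‖G (p + A e) - G p‖ ^ 2)
      (fun _ => Finset.sum_nonneg fun _ _ => sq_nonneg _) (fun i j k _ _ _ => ?_)
      (hr (by omega)) (hr (by omega)) (hr (by omega))
    beta_reduce
    rw [h010 i j k]
    exact Finset.single_le_sum (f := fun e => ‖G (ψ i j k + A e) - G (ψ i j k)‖ ^ 2)
      (fun _ _ => sq_nonneg _) hm₂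
  · -- `S_{1} ≤ T₁`
    refine Blowdown.sum_box_le_tsum_sitesBall hA hI hmem hinj
      (F := fun p => ∑ e ∈ gens, ‖G (p + A e) - G p‖ ^ 2)
      (fun _ => Finset.sum_nonneg fun _ _ => sq_nonneg _) (fun i j k _ _ _ => ?_)
      (hr (by omega)) (hr (by omega)) (hr (by omega))
    beta_reduce
    rw [h100 i j k]
    exact Finset.single_le_sum (f := fun e => ‖G (ψ i j k + A e) - G (ψ i j k)‖ ^ 2)
      (fun _ _ => sq_nonneg _) hm₁
  · -- `S_{1,2} ≤ T₂`
    refine Blowdown.sum_box_le_tsum_sitesBall hA hI hmem hinj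
      (F := fun p => ∑ e ∈ gens, ∑ e' ∈ gens, ‖G (p + A e + A e') - G (p + A e) - G (p + A e') + G p‖ ^ 2)
      (fun _ => Finset.sum_nonneg fun _ _ => Finset.sum_nonneg fun _ _ => sq_nonneg _)
      (fun i j k _ _ _ => ?_)
      (hr (by omega)) (hr (by omega)) (hr (by omega))
    beta_reduce
    rw [h110 i j k, h010 i j k, h100 i j k, Blowdown.norm_diff₂_eq]
    exact Blowdown.le_sum_sum
      (fun e e' => ‖G (ψ i j k + A e + A e') - G (ψ i j k + A e) - G (ψ i j k + A e') + G (ψ i j k)‖ ^ 2)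
      (fun _ _ => sq_nonneg _) hm₂ hm₁
  · -- `S_{3} ≤ T₁`
    refine Blowdown.sum_box_le_tsum_sitesBall hA hI hmem hinj
      (F := fun p => ∑ e ∈ gens, ‖G (p + A e) - G p‖ ^ 2)
      (fun _ => Finset.sum_nonneg fun _ _ => sq_nonneg _) (fun i j k _ _ _ => ?_)
      (hr (by omega)) (hr (by omega)) (hr (by omega))
    beta_reduce
    rw [h001 i j k]
    exact Finset.single_le_sum (f := fun e => ‖G (ψ i j k + A e) - G (ψ i j k)‖ ^ 2)
      (fun _ _ => sq_nonneg _) hm₃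
  · -- `S_{2,3} ≤ T₂`
    refine Blowdown.sum_box_le_tsum_sitesBall hA hI hmem hinj
      (F := fun p => ∑ e ∈ gens, ∑ e' ∈ gens, ‖G (p + A e + A e') - G (p + A e) - G (p + A e') + G p‖ ^ 2)
      (fun _ => Finset.sum_nonneg fun _ _ => Finset.sum_nonneg fun _ _ => sq_nonneg _)
      (fun i j k _ _ _ => ?_)
      (hr (by omega)) (hr (by omega)) (hr (by omega))
    beta_reduce
    rw [h011 i j k, h010 i j k, h001 i j k, Blowdown.norm_diff₂_eq]
    exact Blowdown.le_sum_sum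
      (fun e e' => ‖G (ψ i j k + A e + A e') - G (ψ i j k + A e) - G (ψ i j k + A e') + G (ψ i j k)‖ ^ 2)
      (fun _ _ => sq_nonneg _) hm₂ hm₃
  · -- `S_{1,3} ≤ T₂`
    refine Blowdown.sum_box_le_tsum_sitesBall hA hI hmem hinj
      (F := fun p => ∑ e ∈ gens, ∑ e' ∈ gens, ‖G (p + A e + A e') - G (p + A e) - G (p + A e') + G p‖ ^ 2)
      (fun _ => Finset.sum_nonneg fun _ _ => Finset.sum_nonneg fun _ _ => sq_nonneg _)
      (fun i j k _ _ _ => ?_)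
      (hr (by omega)) (hr (by omega)) (hr (by omega))
    beta_reduce
    rw [h101 i j k, h100 i j k, h001 i j k, Blowdown.norm_diff₂_eq]
    exact Blowdown.le_sum_sum
      (fun e e' => ‖G (ψ i j k + A e + A e') - G (ψ i j k + A e) - G (ψ i j k + A e') + G (ψ i j k)‖ ^ 2)
      (fun _ _ => sq_nonneg _) hm₁ hm₃
  · -- `S_{1,2,3} ≤ T₃`
    refine Blowdown.sum_box_le_tsum_sitesBall hA hI hmem hinj
      (F := fun p => ∑ e ∈ gens, ∑ e' ∈ gens, ∑ e'' ∈ gens,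
        ‖G (p + A e + A e' + A e'') - G (p + A e + A e') - G (p + A e + A e'') - G (p + A e' + A e'') +
          G (p + A e) + G (p + A e') + G (p + A e'') - G p‖ ^ 2)
      (fun _ => Finset.sum_nonneg fun _ _ => Finset.sum_nonneg fun _ _ => Finset.sum_nonneg fun _ _ =>
        sq_nonneg _)
      (fun i j k _ _ _ => ?_)
      (hr (by omega)) (hr (by omega)) (hr (by omega))
    beta_reduce
    rw [h111 i j k, h110 i j k, h011 i j k, h101 i j k, h100 i j k, h010 i j k, h001 i j k,
      Blowdown.norm_diff₃_eq]
    exact Blowdown.le_sum_sum_sum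
      (fun e e' e'' => ‖G (ψ i j k + A e + A e' + A e'') - G (ψ i j k + A e + A e') -
        G (ψ i j k + A e + A e'') - G (ψ i j k + A e' + A e'') + G (ψ i j k + A e) + G (ψ i j k + A e') +
        G (ψ i j k + A e'') - G (ψ i j k)‖ ^ 2)
      (fun _ _ _ => sq_nonneg _) hm₂ hm₁ hm₃

end Summit.AtomisticToContinuum.Crystallization.Theorems.ExcessDecayLiouville

end
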